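import Literature.NumberTheory.Automorphic.LanglandsTunnellModThree
import Literature.NumberTheory.Automorphic.StrongArtinGL2Proofs
import Literature.NumberTheory.Automorphic.PiOfArtinRepFrobSatakeCompatibleProofs
import Literature.NumberTheory.Automorphic.BCDTModularitySerreProofs
import Literature.NumberTheory.Automorphic.BCDTTheoremB
import Literature.NumberTheory.Automorphic.ArthurClozelNilpotentStrongArtin
import Literature.NumberTheory.GaloisRepresentations.SerreOpenImageGroupLemmas
import Literature.NumberTheory.GaloisRepresentations.AbsGaloisGroup
import Literature.NumberTheory.EllipticCurves.CMNewformOfHeckeCharacter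
import Mathlib.GroupTheory.Nilpotent
import HarnessLib

/-!
# Stub-ideation k1, GENERATION 5 (HOME FAMILY 1 — recognise & import) for `stub_modThree`

Companion of `STUB-IDEAS-stub_modThree-1.md` (gen 5).  Delta w.r.t. gen 4
(`STUB_IDEAS_stub_modThree_1_g4.lean`, ns `…K1G4`, ★A″ =
`H1 → H3 → QuadraticInductionRat → StrongArtinOctahedralRat → exists_isNewform1_of_isPiOfArtinRep → StubModThree`):

* **N1 (tree match, PROVED here).** "surjective or a 2-group": for `ρ̄ : Γ_ℚ → GL₂(𝔽₃)` irreducible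
  and odd, either `ρ̄` is onto or its image is a `2`-group.  Serre 1972 §2.4 Prop. 15 in the tree's
  form `Serre1972.eq_top_or_borel_of_dvd_card` (an element of order `3` + `det` onto ⇒ `G = GL₂` or
  Borel), the Borel case contradicting irreducibility (no invariant line, inlined),
  so `3 ∤ #G ∣ 48` and `#G ∣ 16` (`GL2F3Lift.card_GL_fin_two_zmod_three`, `IsPGroup.of_card`).
* **N2 (Mathlib match, PROVED).** a `2`-group image lifts along `Ψ` to a NILPOTENT image of `σ = Ψ ∘ ρ̄`
  (`IsPGroup.map`, `IsPGroup.isNilpotent`, `finite_range_toMonoidHom`).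
* **N3 (literature match = ONE catalogued tree fact).** Arthur–Clozel 1989 Ch. 3 Thm. 7.1, vendored as
  `ArthurClozel1989_strongArtin_nilpotent` (already wanted by three Langlands-summit routes), closes the
  whole non-surjective branch with NO dihedral datum, NO Hecke character, NO `QuadraticInductionRat`.
  ★N closer `stub_modThree_of_nilpotent_octahedral`:
  `H1 → ArthurClozel1989_strongArtin_nilpotent → O1 → StrongArtinOctahedralRat → exists_isNewform1_of_isPiOfArtinRep → StubModThree`
  (kernel-checked; every named input is a CATALOGUED `def … : Prop` of the tree or a proved/S-sized helper).
* **★I (finer literature match, typed).** In the 2-group case `σ` is induced from an IMAGINARY quadratic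
  field, so the classical price of the branch is Hecke's 1926 weight-ONE theta series of a finite-order
  character of an imaginary quadratic field = the `k = 1` twin `HeckeWeightOneCMNewform` of the tree's
  `Ribet1977_cmNewform_of_heckeCharacter` (vendored for `2 ≤ k` only, "TODO … k = 1").  With the
  pointwise Galois side `I1ImaginaryQuadraticInduction` the branch lands in `langlands_tunnell σ`
  WITHOUT Gelbart Prop. 4.2 and without any automorphic representation (`langlands_tunnell_of_weightOneCM`,
  kernel-checked from the two Props).

Nothing here is registered; the stub statement is copied verbatim as `StubModThree`.  No `sorry`.
-/

noncomputable section

open scoped MatrixGroups NumberField Polynomial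
open NumberField IsDedekindDomain Polynomial CongruenceSubgroup Field
open Literature.NumberTheory.EllipticCurves
open Literature.NumberTheory.EllipticCurves.ModularForms
open Literature.NumberTheory.Automorphic
open Literature.NumberTheory.GaloisRepresentations
open Literature.NumberTheory.GaloisRepresentations.GL2F3Lift
open WeierstrassCurve
open Matrix

set_option linter.dupNamespace false

namespace Summit.ABC.ABC.Cruxes.FreyModularity.Sketch.StubModThreeIdeasK1G5

/-- The registered stub statement, verbatim. -/
def StubModThree : Prop :=
  ∀ (W : WeierstrassCurve ℚ) [W.IsElliptic] (ρ : ModPGaloisRep ℚ (ZMod 3) 2),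
    W.IsTorsionGaloisRep 3 ρ → FramedRep.IsAbsolutelyIrreducible ρ → ρ.IsModular

/-! ## Carried from gens 2–4 (proved there; short proofs repeated so the file is self-contained) -/

/-- gen-2 **H0** (PROVED): `ρ̄_{E,3}` is odd (`det ρ̄ = χ₃`). -/
theorem isOdd_of_isTorsionGaloisRep_three (W : WeierstrassCurve ℚ) [W.IsElliptic]
    (ρ : ModPGaloisRep ℚ (ZMod 3) 2) (hρ : W.IsTorsionGaloisRep 3 ρ) :
    FramedGaloisRep.IsOdd ρ := by
  haveI : NeZero ((3 : ℕ) : ℚ) := ⟨by norm_num⟩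
  exact ModPGaloisRep.isOdd_of_det_eq_modPCyclotomicCharacterZMod ρ
    (W.det_eq_modPCyclotomicCharacter_of_isTorsionGaloisRep_holds 3 ρ hρ)

/-- gen-2 **H1** as a Prop (PROVED in gen 2 as `…K1G2.isModular_of_langlands_tunnell_at`): per-`σ`
Langlands–Tunnell descent `langlands_tunnell (Ψ ∘ ρ̄) ⇒ ρ̄ modular` (Carayol + DS 6.7 + NSW, all proved). -/
def H1PerSigmaDescent : Prop :=
  ∀ ρ : ModPGaloisRep ℚ (ZMod 3) 2, langlands_tunnell (modThreeLift ρ) →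
    FramedRep.IsAbsolutelyIrreducible ρ → FramedGaloisRep.IsOdd ρ → ρ.IsModular

/-- gen-2 **H4** (PROVED; 8 lines repeated): Langlands–Tunnell for ONE `σ` from `π(σ)` and
Gelbart Prop. 4.2; Prop. 4.1 is the tree THEOREM `frobSatakeCompatibleAt_of_isPiOfArtinRep_holds`. -/
theorem langlands_tunnell_of_exists_isPiOfArtinRep (hW1 : exists_isNewform1_of_isPiOfArtinRep)
    (σ : FramedArtinRep ℚ 2)
    (hπ : σ.toGaloisRep.IsIrreducible →
      ∃ (hcpt : isCompact_glFiniteIntegralLevel 2 ℚ) (π : CuspidalAutomorphicRepData 2 ℚ hcpt),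
        IsPiOfArtinRep σ π.1) :
    langlands_tunnell σ := by
  intro hirr hodd _hsolv
  obtain ⟨hcpt, π, hπ⟩ := hπ hirr
  obtain ⟨N, hN, f, hf, -, hsat⟩ := hW1 hcpt σ π hirr hodd hπ
  refine ⟨N, hN, f, hf, fun v hv => ?_⟩
  obtain ⟨α, hα, hpoly⟩ := hsat v hv
  obtain ⟨hur, hchar⟩ := frobSatakeCompatibleAt_of_isPiOfArtinRep_holds hcpt σ π hπ v α hα
  exact ⟨hur, hpoly ▸ hchar⟩

/-- gen-4 **Tunnell 1981 over `ℚ`** (the catalogued `strongArtin_of_isOctahedralType` restricted to `ℚ`). -/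
def StrongArtinOctahedralRat : Prop :=
  ∀ σ : FramedArtinRep ℚ 2, σ.toGaloisRep.IsIrreducible → IsOctahedralType σ.toMonoidHom →
    ∃ (hcpt : isCompact_glFiniteIntegralLevel 2 ℚ) (π : CuspidalAutomorphicRepData 2 ℚ hcpt),
      IsPiOfArtinRep σ π.1

/-- The catalogued fact implies its `ℚ`-restriction (bookkeeping, PROVED). -/
theorem strongArtinOctahedralRat_of_fact (ho : strongArtin_of_isOctahedralType) :
    StrongArtinOctahedralRat :=
  fun σ hirr hO => ho σ hirr hO

/-- gen-3 **O1** as a Prop (typed in gen 3 as `…K1G3.isOctahedralType_modThreeLift_of_surjective`, S: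
`PGL₂(𝔽₃) ≃ S₄` and `Ψ` preserves the projective image). -/
def O1OctahedralOfSurjective : Prop :=
  ∀ ρ : ModPGaloisRep ℚ (ZMod 3) 2, Function.Surjective ρ → IsOctahedralType (modThreeLift ρ).toMonoidHom

/-! ## N1 — "surjective or a 2-group" (Serre 1972 Prop. 15, tree form), PROVED -/

/-- **N1a** (PROVED): an odd `ρ̄ : Γ_ℚ → GL₂(𝔽₃)` has `det` ONTO `𝔽₃ˣ = {±1}` on its image
(complex conjugation exists, `exists_isComplexConjugation`, and has `det = -1`). -/
theorem det_surjOn_range_of_isOdd (ρ : ModPGaloisRep ℚ (ZMod 3) 2) (hodd : FramedGaloisRep.IsOdd ρ) :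
    ∀ u : (ZMod 3)ˣ, ∃ g ∈ ρ.toMonoidHom.range, Matrix.GeneralLinearGroup.det g = u := by
  obtain ⟨c, hc⟩ := exists_isComplexConjugation (Rat.castHom ℝ)
  have hc' : Matrix.GeneralLinearGroup.det (ρ c) = -1 := hodd (Rat.castHom ℝ) c hc
  intro u
  obtain rfl | rfl : u = 1 ∨ u = -1 := by revert u; decide
  · exact ⟨1, one_mem _, map_one _⟩
  · exact ⟨ρ c, ⟨c, rfl⟩, hc'⟩

/-- **N1b** (PROVED): an irreducible `ρ̄` has image in NO Borel subgroup (no common eigenline; the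
10-line invariant-line argument of `ProjectiveType.not_isIrreducible_of_isCyclicType` /
`SolvableCharTwo.exists_not_mem_eigenvectorStabilizer`, inlined to keep the import cone small). -/
theorem not_range_le_eigenvectorStabilizer (ρ : ModPGaloisRep ℚ (ZMod 3) 2)
    (hirr : FramedRep.IsIrreducible ρ) (v : Fin 2 → ZMod 3) (hv : v ≠ 0) :
    ¬ ρ.toMonoidHom.range ≤ eigenvectorStabilizer v hv := by
  intro hle
  have key : ∀ g : absoluteGaloisGroup ℚ, ∃ a : ZMod 3,
      ((ρ g : GL (Fin 2) (ZMod 3)) : Matrix (Fin 2) (Fin 2) (ZMod 3)) *ᵥ v = a • v :=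
    fun g ↦ mem_eigenvectorStabilizer_iff.mp (hle ⟨g, rfl⟩)
  have hirr' : IsSimpleOrder (Subrepresentation (FramedRep.toRepresentation ρ)) := hirr
  let S : Subrepresentation (FramedRep.toRepresentation ρ) :=
    { toSubmodule := (ZMod 3) ∙ v
      apply_mem_toSubmodule := by
        intro g w hw
        obtain ⟨b, rfl⟩ := Submodule.mem_span_singleton.mp hw
        obtain ⟨a, ha⟩ := key g
        rw [FramedRep.toRepresentation_apply_apply, Matrix.mulVec_smul, ha, smul_smul]
        exact Submodule.mem_span_singleton.mpr ⟨b * a, rfl⟩ }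
  rcases hirr'.eq_bot_or_eq_top S with hS | hS
  · have hvS : v ∈ S := Submodule.mem_span_singleton_self v
    rw [hS] at hvS
    exact hv ((Submodule.mem_bot (ZMod 3)).mp hvS)
  · have h1 : Module.finrank (ZMod 3) ((ZMod 3) ∙ v) = 1 := finrank_span_singleton hv
    have h2 : ((ZMod 3) ∙ v : Submodule (ZMod 3) (Fin 2 → ZMod 3)) = ⊤ :=
      congrArg Subrepresentation.toSubmodule hS
    rw [h2, finrank_top, Module.finrank_fin_fun] at h1
    exact absurd h1 (by norm_num)

/-- **N1** (PROVED): for `ρ̄ : Γ_ℚ → GL₂(𝔽₃)` irreducible and odd, EITHER `ρ̄` is surjective OR its image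
is a `2`-group.  (Serre's Prop. 15: `3 ∣ #G` and `det G = 𝔽₃ˣ` force `G = GL₂(𝔽₃)` or `G` Borel; the
latter is reducible; so `3 ∤ #G ∣ 48`, i.e. `#G ∣ 16`.) -/
theorem surjective_or_isPGroup_two (ρ : ModPGaloisRep ℚ (ZMod 3) 2)
    (hirr : FramedRep.IsIrreducible ρ) (hodd : FramedGaloisRep.IsOdd ρ) :
    Function.Surjective ρ ∨ IsPGroup 2 ρ.toMonoidHom.range := by
  classical
  haveI : Fact (Nat.Prime 3) := ⟨Nat.prime_three⟩
  set G := ρ.toMonoidHom.range with hG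
  by_cases hs : Function.Surjective ρ
  · exact Or.inl hs
  refine Or.inr ?_
  have h3 : ¬ 3 ∣ Nat.card G := by
    intro h
    rcases Serre1972.eq_top_or_borel_of_dvd_card G h (det_surjOn_range_of_isOdd ρ hodd) with
      htop | ⟨v, hv, hle⟩
    · exact hs (MonoidHom.range_eq_top.mp htop)
    · exact not_range_le_eigenvectorStabilizer ρ hirr v hv hle
  have h48 : Nat.card G ∣ 2 ^ 4 * 3 := by
    have h := Subgroup.card_subgroup_dvd_card G
    rwa [card_GL_fin_two_zmod_three] at h
  have h16 : Nat.card G ∣ 2 ^ 4 :=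
    Nat.Coprime.dvd_of_dvd_mul_right ((Nat.Prime.coprime_iff_not_dvd Nat.prime_three).mpr h3).symm h48
  obtain ⟨k, -, hk⟩ := (Nat.dvd_prime_pow Nat.prime_two).1 h16
  exact IsPGroup.of_card hk

/-! ## N2 — a 2-group image lifts to a NILPOTENT image of `σ = Ψ ∘ ρ̄`, PROVED (Mathlib) -/

/-- **N2** (PROVED): `(Ψ ∘ ρ̄)(Γ_ℚ) = Ψ(ρ̄(Γ_ℚ))` is a `2`-group, hence nilpotent
(`IsPGroup.map`, `IsPGroup.isNilpotent`). -/
theorem isNilpotent_range_modThreeLift_of_isPGroup (ρ : ModPGaloisRep ℚ (ZMod 3) 2)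
    (h : IsPGroup 2 ρ.toMonoidHom.range) :
    Group.IsNilpotent (modThreeLift ρ).toMonoidHom.range := by
  haveI : Fact (Nat.Prime 2) := ⟨Nat.prime_two⟩
  haveI : Finite (modThreeLift ρ).toMonoidHom.range := finite_range_toMonoidHom (modThreeLift ρ)
  have hr : (modThreeLift ρ).toMonoidHom.range = (ρ.toMonoidHom.range).map psi := by
    rw [← MonoidHom.range_comp]; rfl
  have hP : IsPGroup 2 (modThreeLift ρ).toMonoidHom.range := by
    rw [hr]; exact h.map psi
  exact hP.isNilpotent

/-! ## N3 — the non-surjective branch is ONE catalogued fact: Arthur–Clozel Ch. 3 Thm. 7.1 -/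

/-- **N3** (PROVED from the catalogued fact): for `ρ̄` with `2`-group image, `σ = Ψ ∘ ρ̄` (irreducible)
is a.e.-cuspidal-automorphic by `ArthurClozel1989_strongArtin_nilpotent`. -/
theorem exists_isPiOfArtinRep_of_isPGroup_two (hAC : ArthurClozel1989_strongArtin_nilpotent)
    (ρ : ModPGaloisRep ℚ (ZMod 3) 2) (h2 : IsPGroup 2 ρ.toMonoidHom.range)
    (hirr : (modThreeLift ρ).toGaloisRep.IsIrreducible) :
    ∃ (hcpt : isCompact_glFiniteIntegralLevel 2 ℚ) (π : CuspidalAutomorphicRepData 2 ℚ hcpt),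
      IsPiOfArtinRep (modThreeLift ρ) π.1 :=
  hAC (modThreeLift ρ) two_pos hirr (isNilpotent_range_modThreeLift_of_isPGroup ρ h2)

/-- **Langlands–Tunnell at `σ = Ψ ∘ ρ̄` from {AC Thm. 7.1, Tunnell/ℚ, Gelbart 4.2} and O1** (PROVED):
Langlands' tetrahedral theorem and the dihedral/JL leaf are never invoked. -/
theorem langlands_tunnell_modThreeLift_of_nilpotent_octahedral
    (hAC : ArthurClozel1989_strongArtin_nilpotent) (hO1 : O1OctahedralOfSurjective)
    (ho : StrongArtinOctahedralRat) (hW1 : exists_isNewform1_of_isPiOfArtinRep)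
    (ρ : ModPGaloisRep ℚ (ZMod 3) 2) (hirr : FramedRep.IsIrreducible ρ)
    (hodd : FramedGaloisRep.IsOdd ρ) : langlands_tunnell (modThreeLift ρ) :=
  langlands_tunnell_of_exists_isPiOfArtinRep hW1 (modThreeLift ρ) fun hirr' ↦
    (surjective_or_isPGroup_two ρ hirr hodd).elim
      (fun hs ↦ ho (modThreeLift ρ) hirr' (hO1 ρ hs))
      (fun h2 ↦ exists_isPiOfArtinRep_of_isPGroup_two hAC ρ h2 hirr')

/-- ★N **The gen-5 closer** (kernel-checked): `stub_modThree` from the catalogued facts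
{`ArthurClozel1989_strongArtin_nilpotent`, Tunnell-octahedral over `ℚ`, Gelbart Prop. 4.2}, granted
gen-2's PROVED H1 and gen-3's S-sized O1.  Compare gen 4's `stub_modThree_of_quadInductionRat_octahedral`
(inputs H3 + `QuadraticInductionRat` in place of the single fact `hAC`). -/
theorem stub_modThree_of_nilpotent_octahedral (hH1 : H1PerSigmaDescent)
    (hAC : ArthurClozel1989_strongArtin_nilpotent) (hO1 : O1OctahedralOfSurjective)
    (ho : StrongArtinOctahedralRat) (hW1 : exists_isNewform1_of_isPiOfArtinRep) : StubModThree := by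
  intro W _ ρ hρ habs
  have hodd := isOdd_of_isTorsionGaloisRep_three W ρ hρ
  exact hH1 ρ (langlands_tunnell_modThreeLift_of_nilpotent_octahedral hAC hO1 ho hW1 ρ
    habs.isIrreducible hodd) habs hodd

/-- The same closer fed with the catalogued octahedral fact (PROVED). -/
theorem stub_modThree_of_nilpotent_octahedral' (hH1 : H1PerSigmaDescent)
    (hAC : ArthurClozel1989_strongArtin_nilpotent) (hO1 : O1OctahedralOfSurjective)
    (ho : strongArtin_of_isOctahedralType) (hW1 : exists_isNewform1_of_isPiOfArtinRep) : StubModThree :=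
  stub_modThree_of_nilpotent_octahedral hH1 hAC hO1 (strongArtinOctahedralRat_of_fact ho) hW1

/-! ## ★I — the finer classical pricing of the non-surjective branch: Hecke 1926, weight ONE -/

/-- **I1 (Galois side, pointwise; M-sized, to prove).**  For `ρ̄` irreducible, odd, with `2`-group
image (`G ∈ {N(C_s) ≅ D₄, N(C_ns) ≅ SD₁₆}`), `σ = Ψ ∘ ρ̄` is induced from a finite-order character of
an IMAGINARY quadratic field `M` (take `A =` the unique cyclic index-`2` subgroup of `G`: `C₄ = G ∩ SL₂`
for `D₄`, so `M = ℚ(√-3)`; `C₈` for `SD₁₆`; `A` contains no involution of determinant `-1`, so complex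
conjugation is not in `Γ_M`), not fixed by `Gal(M/ℚ)`, matched by class field theory with an idelic
`ψ`; and AT EVERY rational place `v` unramified in `M` with `ψ` unramified above `v`, `σ` is unramified
with Frobenius polynomial `∏_{w ∣ v} (X^{f(w|v)} - ψ(ϖ_w))` (tree: `FramedGaloisRep.hasFrobCharpolyAt_induce`
pointwise + `artinReciprocity_character_holds`; the tree's packaged dihedral theorem
`exists_heckeCharacter_frobPoly_of_isDihedralType` is the a.e. shadow of this). -/
def I1ImaginaryQuadraticInduction : Prop :=
  ∀ ρ : ModPGaloisRep ℚ (ZMod 3) 2, FramedRep.IsIrreducible ρ → FramedGaloisRep.IsOdd ρ →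
    IsPGroup 2 ρ.toMonoidHom.range →
    ∃ (M : Type) (_ : Field M) (_ : NumberField M), Module.finrank ℚ M = 2 ∧ ¬ IsTotallyReal M ∧
      ∃ ψ : HeckeCharacter M, ψ.IsFiniteOrder ∧
        (∃ (τ : M ≃ₐ[ℚ] M) (x : ideleGroup M), ψ (τ • x) ≠ ψ x) ∧
        ∀ v : HeightOneSpectrum (𝓞 ℚ), v.asIdeal.ramificationIdxIn (𝓞 M) = 1 →
          (∀ w : HeightOneSpectrum (𝓞 M), w.asIdeal.under (𝓞 ℚ) = v.asIdeal → ψ.IsUnramifiedAt w) →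
          (modThreeLift ρ).IsUnramifiedAt v ∧
            (modThreeLift ρ).HasFrobCharpolyAt v
              (inducedFrobPolynomial v (fun w => X - C (ψ.valueAtUniformizer w)))

/-- **CM1 = Hecke 1926 (weight one), the `k = 1` twin of `Ribet1977_cmNewform_of_heckeCharacter`**
(candidate NAMED FACT to vendor; Hecke, Math. Ann. 97; Miyake Thm. 4.8.2 with `u = 0`; Serre 1977 §7;
Diamond–Shurman §4.11 is the worked case `A = ℤ[μ₃]`): for `K` imaginary quadratic and `ψ` a
finite-order idelic Hecke character of `K` NOT fixed by `Gal(K/ℚ)` (else `θ_ψ` is Eisenstein), there is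
a newform `f ∈ S₁(Γ₁(N))` whose Hecke polynomial at every `p ∤ N` is `∏_{w ∣ p} (X^{f(w|p)} - ψ(ϖ_w))`,
with `p` unramified in `K` and `ψ` unramified above `p`.  Same rendering as the `k ≥ 2` fact. -/
def HeckeWeightOneCMNewform : Prop :=
  ∀ (K : Type) [Field K] [NumberField K], Module.finrank ℚ K = 2 → ¬ IsTotallyReal K →
    ∀ (ψ : HeckeCharacter K), ψ.IsFiniteOrder →
    (∃ (τ : K ≃ₐ[ℚ] K) (x : ideleGroup K), ψ (τ • x) ≠ ψ x) →
    ∃ (N : ℕ) (_ : NeZero N) (f : CuspForm (Gamma1 N) 1), IsNewform1 f ∧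
      ∀ v : HeightOneSpectrum (𝓞 ℚ),
        ¬ ((Rat.HeightOneSpectrum.primesEquiv v : Nat.Primes) : ℕ) ∣ N →
        v.asIdeal.ramificationIdxIn (𝓞 K) = 1 ∧
        (∀ w : HeightOneSpectrum (𝓞 K), w.asIdeal.under (𝓞 ℚ) = v.asIdeal → ψ.IsUnramifiedAt w) ∧
        (heckePolynomial f (Rat.HeightOneSpectrum.primesEquiv v : Nat.Primes)).map
            (algebraMap (coeffCharField f) ℂ) =
          inducedFrobPolynomial v (fun w => X - C (ψ.valueAtUniformizer w))

/-- ★I **Langlands–Tunnell at `σ = Ψ ∘ ρ̄` in the 2-group case from {I1, CM1} ALONE** (PROVED from the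
two Props): no automorphic representation, no Gelbart Prop. 4.2, no a.e.-to-everywhere upgrade. -/
theorem langlands_tunnell_of_weightOneCM (hI1 : I1ImaginaryQuadraticInduction)
    (hCM : HeckeWeightOneCMNewform) (ρ : ModPGaloisRep ℚ (ZMod 3) 2)
    (hirr : FramedRep.IsIrreducible ρ) (hodd : FramedGaloisRep.IsOdd ρ)
    (h2 : IsPGroup 2 ρ.toMonoidHom.range) : langlands_tunnell (modThreeLift ρ) := by
  intro _ _ _
  obtain ⟨M, _, _, hdeg, hMi, ψ, hfin, hreg, hfrob⟩ := hI1 ρ hirr hodd h2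
  obtain ⟨N, hN, f, hf, hmatch⟩ := hCM M hdeg hMi ψ hfin hreg
  refine ⟨N, hN, f, hf, fun v hv => ?_⟩
  obtain ⟨hram, hunr, hpoly⟩ := hmatch v hv
  obtain ⟨hσ, hchar⟩ := hfrob v hram hunr
  exact ⟨hσ, hpoly ▸ hchar⟩

/-- ★I closer (kernel-checked): `stub_modThree` from {I1, CM1} on the non-surjective branch and
{Tunnell/ℚ, Gelbart 4.2, O1} on the surjective one, granted H1. -/
theorem stub_modThree_of_weightOneCM_octahedral (hH1 : H1PerSigmaDescent)
    (hI1 : I1ImaginaryQuadraticInduction) (hCM : HeckeWeightOneCMNewform)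
    (hO1 : O1OctahedralOfSurjective) (ho : StrongArtinOctahedralRat)
    (hW1 : exists_isNewform1_of_isPiOfArtinRep) : StubModThree := by
  intro W _ ρ hρ habs
  have hodd := isOdd_of_isTorsionGaloisRep_three W ρ hρ
  refine hH1 ρ ?_ habs hodd
  rcases surjective_or_isPGroup_two ρ habs.isIrreducible hodd with hs | h2
  · exact langlands_tunnell_of_exists_isPiOfArtinRep hW1 (modThreeLift ρ) fun hirr ↦
      ho (modThreeLift ρ) hirr (hO1 ρ hs)
  · exact langlands_tunnell_of_weightOneCM hI1 hCM ρ habs.isIrreducible hodd h2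

end Summit.ABC.ABC.Cruxes.FreyModularity.Sketch.StubModThreeIdeasK1G5

end
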